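import Summits.Parity.BatemanHorn.Theorems.RoughValueTransportBalancedSemiprimeLayerRhoPrimeWindowSum
import Summits.Parity.BatemanHorn.Theorems.RoughValueTransportBalancedSemiprimeLayerRoughWindowRhoSum
import Summits.Parity.BatemanHorn.Theorems.RoughValueTransportBalancedSemiprimeLayerRoughWindowInjection
import Summits.Parity.BatemanHorn.Theorems.RoughValueTransportBalancedSemiprimeLayerDensityProductLe
import Summits.Parity.BatemanHorn.Theorems.RoughValueTransportBalancedSemiprimeLayerRoughWindowSieveStep
import Summits.Parity.BatemanHorn.Theorems.BalancedSemiprimeLayer.Negative.NatDegreePos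
import Literature.NumberTheory.Sieve.BatemanHornProofs
import Literature.NumberTheory.Sieve.BatemanHornMertensProduct
import HarnessLib

/-!
# Route `RoughValueTransport`, crux `BalancedSemiprimeLayer` (stmt-Parity-9469), line
# `rough-relaxed-divisor-sieve` (companion lead c1): THE LEVER `stub_roughWindowLever`

The degree-blind lever of the skeleton `Cruxes/BalancedSemiprimeLayer/Lines/rough_relaxed_divisor_sieve_c1.lean`:
for EVERY coordinate `i` of EVERY Bateman–Horn system `f` of `k` polynomials,
`IsBatemanHornSystem f → RoughWindowTypeI f i → CoordLayerThin f i` — Type-I information at level `x^c`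
for the rough balanced-divisor line of coordinate `i` (`RoughWindowTypeI`, the window variable inside the
absolute value; vocabulary in `Theorems/RoughValueTransportDefs.lean`) implies that the coordinate-`i`
layer of the crux `BalancedSemiprimeLayer` is thin.  `lever_of_anchors` derives it from the five LANDED
anchors taken as hypotheses — A `stub_rhoPrimeWindowSum` (Mertens for `ρ` over primes in windows, upper
form), B `stub_roughWindowRhoSum` (size of the weighted line `≤ dᵢ²δ/c² + o(1)`), C
`stub_coordLayer_le_sifted` (injection: relax both balanced primes), D `stub_densityProduct_le`
(`V(x^c) ≤ K/(log x)^k`), E `stub_sifted_le` (the `k`-dimensional sieve step) — and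
`stub_roughWindowLever` applies it to them.  Consequence (skeleton r3): the crux is closed modulo the single
registered stub `stub_roughWindowTypeI_highDegree` (`RoughWindowTypeI` for coordinates of degree `≥ 3`, a
pure Type-I statement; degree `≤ 2` is the landed `layerConclusion_of_natDegree_le_two`).  Nothing is
assumed beyond the tree.  Reference for the mechanism: C. Hooley, Acta Math. 117 (1967) 281–299 (the
divisor-switched sieve); the Fundamental Lemma used is the tree's `fundamental_lemma_uniform_holds`.

Assembly (paper): given `ε > 0` take `c = min(c₀, 1/4)` (`c₀` from `RoughWindowTypeI`), constants
`C_FL` (E), `K` (D, at `c`), and `δ = min(c, ε/(2(1 + C_FL)K(dᵢ²/c² + 1)))`; eventually in `x`,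
`E_{f,i}(x,δ) ≤ dᵢ + S ≤ dᵢ + (1 + C_FL)·x·(dᵢ²δ/c² + δ)·K/(log x)^k + x^{1−η} ≤ ε·x/(log x)^k`.
-/

noncomputable section

open Polynomial Filter Finset
open Literature.NumberTheory.Sieve
open scoped BigOperators

namespace Summit.Parity.BatemanHorn.Cruxes.BalancedSemiprimeLayer.RoughRelaxedDivisorSieve

open Summit.Parity.BatemanHorn.Cruxes.BalancedSemiprimeLayer.SmoothModulusTwistedHooley
  (coordLayer CoordLayerThin)
open Summit.Parity.BatemanHorn.Theorems.BalancedSemiprimeLayer.Negative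
  (natDegree_pos_of_isBatemanHornSystem)

/-- The absorption of the lower-order terms: for `0 < η ≤ 1`, eventually
`d + x^{1−η} ≤ ε'·x/(log x)^k`. [folklore] -/
theorem eventually_const_add_rpow_le {η ε' : ℝ} (hη : 0 < η) (hη1 : η ≤ 1) (hε' : 0 < ε') (d : ℝ)
    (k : ℕ) : ∀ᶠ x : ℕ in atTop, d + (x : ℝ) ^ (1 - η) ≤ ε' * (x : ℝ) / Real.log x ^ k := by
  -- `(log x)^k ≤ x^{η/2}`, `x^{-η/2} ≤ ε'/4` and `d ≤ x^{1-η/2}·ε'/4` eventually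
  have h1 : ∀ᶠ x : ℝ in atTop, Real.log x ^ k ≤ x ^ (η / 2) := by
    have h := (isLittleO_log_rpow_rpow_atTop (k : ℝ) (half_pos hη)).bound one_pos
    filter_upwards [h, eventually_ge_atTop (1 : ℝ)] with x hx hx1
    rw [one_mul, Real.norm_of_nonneg (Real.rpow_nonneg (Real.log_nonneg hx1) _),
      Real.norm_of_nonneg (by positivity)] at hx
    simpa [Real.rpow_natCast] using hx
  have h2 : ∀ᶠ x : ℝ in atTop, x ^ (-(η / 2)) ≤ ε' / 4 :=
    (tendsto_rpow_neg_atTop (half_pos hη)).eventually (ge_mem_nhds (by positivity))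
  have h3 : ∀ᶠ x : ℝ in atTop, d ≤ x ^ (1 - η / 2) * (ε' / 4) :=
    ((tendsto_rpow_atTop (by linarith)).atTop_mul_const (by positivity)).eventually_ge_atTop d
  have h4 := ((h1.and h2).and h3).and (eventually_gt_atTop (1 : ℝ))
  filter_upwards [tendsto_natCast_atTop_atTop.eventually h4] with x hx
  obtain ⟨⟨⟨hlog, hsmall⟩, hd⟩, hx1⟩ := hx
  have hx0 : (0 : ℝ) < x := by linarith
  have hlogpos : 0 < Real.log x := Real.log_pos hx1
  have hlk : 0 < Real.log (x : ℝ) ^ k := pow_pos hlogpos k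
  rw [le_div_iff₀ hlk]
  have hsplit : (x : ℝ) = (x : ℝ) ^ (1 - η / 2) * (x : ℝ) ^ (η / 2) := by
    rw [← Real.rpow_add hx0]; norm_num
  have hsplit' : (x : ℝ) ^ (1 - η) = (x : ℝ) ^ (1 - η / 2) * (x : ℝ) ^ (-(η / 2)) := by
    rw [← Real.rpow_add hx0]; ring_nf
  have hxη2 : 0 ≤ (x : ℝ) ^ (1 - η / 2) := Real.rpow_nonneg hx0.le _
  have hxη : (x : ℝ) ^ (1 - η) ≤ (x : ℝ) ^ (1 - η / 2) * (ε' / 4) := by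
    rw [hsplit']
    exact mul_le_mul_of_nonneg_left hsmall hxη2
  calc (d + (x : ℝ) ^ (1 - η)) * Real.log x ^ k
      ≤ ((x : ℝ) ^ (1 - η / 2) * (ε' / 2)) * (x : ℝ) ^ (η / 2) :=
        mul_le_mul (by linarith) hlog hlk.le (by positivity)
    _ = ε' / 2 * ((x : ℝ) ^ (1 - η / 2) * (x : ℝ) ^ (η / 2)) := by ring
    _ = ε' / 2 * x := by rw [← hsplit]
    _ ≤ ε' * x := by nlinarith

/-- **The lever from its anchors.**  Hypotheses `hA`–`hE` are the registered anchors
`stub_rhoPrimeWindowSum`, `stub_roughWindowRhoSum`, `stub_coordLayer_le_sifted`,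
`stub_densityProduct_le`, `stub_sifted_le` VERBATIM; conclusion = `stub_roughWindowLever`. [folklore] -/
theorem lever_of_anchors
    (hA : ∀ (g : ℤ[X]) (C : ℝ), 0 < C → HasBatemanHornConst ![g] C →
      (∀ p : ℕ, p.Prime → polyRootCountMod ![g] p < p) →
      ∀ θ : ℝ, 0 < θ → ∃ u₀ : ℕ, ∀ u v : ℕ, u₀ ≤ u → u ≤ v →
        (∑ p ∈ (Ioc u v).filter Nat.Prime, (polyRootCountMod ![g] p : ℝ) / p) ≤
          Real.log (Real.log v / Real.log u) + θ)
    (hB : ∀ (g : ℤ[X]),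
      (∀ θ : ℝ, 0 < θ → ∃ u₀ : ℕ, ∀ u v : ℕ, u₀ ≤ u → u ≤ v →
        (∑ p ∈ (Ioc u v).filter Nat.Prime, (polyRootCountMod ![g] p : ℝ) / p) ≤
          Real.log (Real.log v / Real.log u) + θ) →
      ∀ (d : ℕ) (c δ θ : ℝ), 1 ≤ d → 0 < c → c ≤ 1 → 0 < δ → δ ≤ 1 / 2 → 0 < θ →
        ∀ᶠ x : ℕ in atTop,
          (∑ m ∈ roughDivWindow d δ c x, (polyRootCountMod ![g] m : ℝ) / m) ≤
            (d : ℝ) ^ 2 * δ / c ^ 2 + θ)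
    (hC : ∀ (k : ℕ) (f : Fin k → ℤ[X]), IsBatemanHornSystem f → ∀ (i : Fin k) (c δ : ℝ),
      0 < c → c < 3 / 8 → 0 < δ → δ ≤ 1 / 4 → ∀ᶠ x : ℕ in atTop,
        (coordLayer f i δ x : ℝ) ≤ ((f i).natDegree : ℝ) +
          ∑ m ∈ roughDivWindow (f i).natDegree δ c x,
            (#((posRange f x).filter (fun n : ℕ => ((m : ℤ) ∣ (f i).eval (n : ℤ)) ∧
                ((∏ j, f j).eval (n : ℤ)).natAbs.Coprime (primesProdBelow ((x : ℝ) ^ c)))) : ℝ))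
    (hD : ∀ (k : ℕ) (f : Fin k → ℤ[X]), IsBatemanHornSystem f → ∀ c : ℝ, 0 < c →
      ∃ K : ℝ, 0 < K ∧ ∀ᶠ x : ℕ in atTop,
        (∏ p ∈ Nat.primesBelow ⌈(x : ℝ) ^ c⌉₊, (1 - (polyRootCountMod f p : ℝ) / p)) ≤
          K / Real.log x ^ k)
    (hE : ∀ (k : ℕ) (f : Fin k → ℤ[X]), IsBatemanHornSystem f → ∃ CFL : ℝ, 0 ≤ CFL ∧
      ∀ (i : Fin k) (c δ : ℝ), 0 < c → 0 < δ → ∀ x : ℕ, (2 : ℝ) ≤ (x : ℝ) ^ c →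
        (∑ m ∈ roughDivWindow (f i).natDegree δ c x,
            (#((posRange f x).filter (fun n : ℕ => ((m : ℤ) ∣ (f i).eval (n : ℤ)) ∧
                ((∏ j, f j).eval (n : ℤ)).natAbs.Coprime (primesProdBelow ((x : ℝ) ^ c)))) : ℝ)) ≤
          (1 + CFL) * ((x : ℝ) * ∑ m ∈ roughDivWindow (f i).natDegree δ c x,
              (polyRootCountMod ![f i] m : ℝ) / m) *
            (∏ p ∈ Nat.primesBelow ⌈(x : ℝ) ^ c⌉₊, (1 - (polyRootCountMod f p : ℝ) / p)) +
          ∑ e ∈ (Icc 1 ⌊(x : ℝ) ^ c⌋₊).filter Squarefree,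
            |∑ m ∈ roughDivWindow (f i).natDegree δ c x, windowPairRem f i x m e|) :
    ∀ (k : ℕ) (f : Fin k → ℤ[X]), IsBatemanHornSystem f → ∀ i : Fin k,
      RoughWindowTypeI f i → CoordLayerThin f i := by
  intro k f hf i hT ε hε
  -- ## the coordinate `g = fᵢ`, its degree and its Mertens data (anchor A)
  have hd1 : 1 ≤ (f i).natDegree := natDegree_pos_of_isBatemanHornSystem hf i
  have hfi : IsBatemanHornSystem ![f i] := BatemanHornMertens.isBatemanHornSystem_single hf i
  obtain ⟨Cg, hCg0, hCg⟩ := exists_hasBatemanHornConst_holds (ι := Fin 1) hfi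
  have hρlt : ∀ p : ℕ, p.Prime → polyRootCountMod ![f i] p < p := fun p hp =>
    hfi.hasNoFixedPrimeDivisor p hp
  have hW := hA (f i) Cg hCg0 hCg hρlt
  -- ## the exponent `c`
  obtain ⟨c₀, hc₀, hT⟩ := hT
  set c : ℝ := min c₀ (1 / 4) with hcdef
  have hc0 : 0 < c := lt_min hc₀ (by norm_num)
  have hcc₀ : c ≤ c₀ := min_le_left _ _
  have hc4 : c ≤ 1 / 4 := min_le_right _ _
  have hc38 : c < 3 / 8 := by linarith
  have hc1 : c ≤ 1 := by linarith
  -- ## the constants of anchors D and E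
  obtain ⟨K, hK0, hDx⟩ := hD k f hf c hc0
  obtain ⟨CFL, hCFL0, hEx⟩ := hE k f hf
  -- ## the choice of `δ`
  set L : ℝ := 2 * (1 + CFL) * K * (((f i).natDegree : ℝ) ^ 2 / c ^ 2 + 1) with hL
  have hL0 : 0 < L := by positivity
  set δ : ℝ := min c (ε / L) with hδdef
  have hδ0 : 0 < δ := lt_min hc0 (div_pos hε hL0)
  have hδc : δ ≤ c := min_le_left _ _
  have hδ4 : δ ≤ 1 / 4 := hδc.trans hc4
  have hδ2 : δ ≤ 1 / 2 := by linarith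
  have hδL : δ * L ≤ ε := by
    have := min_le_right c (ε / L)
    rwa [← hδdef, le_div_iff₀ hL0] at this
  refine ⟨δ, hδ0, hδ4, ?_⟩
  -- ## the eventual inputs
  obtain ⟨η, hη, hTx⟩ := hT c hc0 hcc₀ δ hδ0 hδc
  set η' : ℝ := min η (1 / 2) with hη'
  have hη'0 : 0 < η' := lt_min hη (by norm_num)
  have hη'1 : η' ≤ 1 := (min_le_right _ _).trans (by norm_num)
  have hηη' : η' ≤ η := min_le_left _ _
  have hBx := hB (f i) hW (f i).natDegree c δ δ hd1 hc0 hc1 hδ0 hδ2 hδ0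
  have hCx := hC k f hf i c δ hc0 hc38 hδ0 hδ4
  have hz2 : ∀ᶠ x : ℕ in atTop, (2 : ℝ) ≤ (x : ℝ) ^ c :=
    ((tendsto_rpow_atTop hc0).comp tendsto_natCast_atTop_atTop).eventually_ge_atTop _
  have habs := eventually_const_add_rpow_le hη'0 hη'1 (half_pos hε) ((f i).natDegree : ℝ) k
  have hlog : ∀ᶠ x : ℕ in atTop, (1 : ℝ) < x := by
    exact_mod_cast eventually_gt_atTop 1
  filter_upwards [hTx, hBx, hCx, hDx, hz2, habs, hlog] with x hTx hBx hCx hDx hz2 habs hx1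
  have hEx' := hEx i c δ hc0 hδ0 x hz2
  -- ## the chain of inequalities
  have hx0 : (0 : ℝ) < x := by linarith
  have hlogpos : 0 < Real.log x := Real.log_pos hx1
  have hlk : 0 < Real.log (x : ℝ) ^ k := pow_pos hlogpos k
  set Sρ := ∑ m ∈ roughDivWindow (f i).natDegree δ c x, (polyRootCountMod ![f i] m : ℝ) / m with hSρ
  set V := ∏ p ∈ Nat.primesBelow ⌈(x : ℝ) ^ c⌉₊, (1 - (polyRootCountMod f p : ℝ) / p) with hV
  set Rm := ∑ e ∈ (Icc 1 ⌊(x : ℝ) ^ c⌋₊).filter Squarefree,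
    |∑ m ∈ roughDivWindow (f i).natDegree δ c x, windowPairRem f i x m e| with hRm
  have hSρ0 : 0 ≤ Sρ := Finset.sum_nonneg fun _ _ => by positivity
  have hTx' : Rm ≤ (x : ℝ) ^ (1 - η') :=
    hTx.trans (Real.rpow_le_rpow_of_exponent_le hx1.le (by linarith))
  have hV0 : 0 ≤ V := by
    refine Finset.prod_nonneg fun p hp => sub_nonneg.mpr ?_
    have hpp := Nat.prime_of_mem_primesBelow hp
    have hp0 : (0 : ℝ) < p := by exact_mod_cast hpp.pos
    rw [div_le_one hp0]
    exact_mod_cast polyRootCountMod_le f p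
  -- main term: (1+CFL)·(x·Sρ)·V ≤ (1+CFL)·x·(d²δ/c²+δ)·K/(log x)^k = (δL/2)·x/(log x)^k
  have hmain : (1 + CFL) * ((x : ℝ) * Sρ) * V ≤ (δ * L / 2) * (x : ℝ) / Real.log x ^ k := by
    have h1 : (x : ℝ) * Sρ ≤ (x : ℝ) * (((f i).natDegree : ℝ) ^ 2 * δ / c ^ 2 + δ) :=
      mul_le_mul_of_nonneg_left hBx hx0.le
    have h2 : (1 + CFL) * ((x : ℝ) * Sρ) * V ≤
        (1 + CFL) * ((x : ℝ) * (((f i).natDegree : ℝ) ^ 2 * δ / c ^ 2 + δ)) *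
          (K / Real.log x ^ k) := by
      refine mul_le_mul (mul_le_mul_of_nonneg_left h1 (by positivity)) hDx hV0 (by positivity)
    refine h2.trans (le_of_eq ?_)
    rw [hL]
    field_simp
  calc (coordLayer f i δ x : ℝ)
      ≤ ((f i).natDegree : ℝ) + ∑ m ∈ roughDivWindow (f i).natDegree δ c x,
          (#((posRange f x).filter (fun n : ℕ => ((m : ℤ) ∣ (f i).eval (n : ℤ)) ∧
              ((∏ j, f j).eval (n : ℤ)).natAbs.Coprime (primesProdBelow ((x : ℝ) ^ c)))) : ℝ) := hCx
    _ ≤ ((f i).natDegree : ℝ) + ((1 + CFL) * ((x : ℝ) * Sρ) * V + Rm) := by gcongr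
    _ ≤ ((f i).natDegree : ℝ) + ((δ * L / 2) * (x : ℝ) / Real.log x ^ k + (x : ℝ) ^ (1 - η')) := by
        gcongr
    _ = (((f i).natDegree : ℝ) + (x : ℝ) ^ (1 - η')) + (δ * L / 2) * (x : ℝ) / Real.log x ^ k := by
        ring
    _ ≤ ε / 2 * (x : ℝ) / Real.log x ^ k + (ε / 2) * (x : ℝ) / Real.log x ^ k :=
        add_le_add habs (div_le_div_of_nonneg_right
          (mul_le_mul_of_nonneg_right (by linarith) hx0.le) hlk.le)
    _ = ε * (x : ℝ) / Real.log x ^ k := by ring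

/-- **S1' `stub_roughWindowLever` — THE LEVER of line `rough-relaxed-divisor-sieve`** (registered stub of
the skeleton `Cruxes/BalancedSemiprimeLayer/Lines/rough_relaxed_divisor_sieve_c1.lean`; degree-blind).  For
every Bateman–Horn system `f` and every coordinate `i`: if the rough balanced-divisor line of coordinate `i`
has level `x^c` (`RoughWindowTypeI f i`), then the coordinate-`i` layer is thin (`CoordLayerThin f i`: for
every `ε > 0` some `δ ∈ (0, 1/4]` makes `E_{f,i}(x, δ) ≤ ε·x/(log x)^k` eventually).  Proof:
`lever_of_anchors` at the landed anchors A–E. [folklore] -/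
theorem stub_roughWindowLever :
    ∀ (k : ℕ) (f : Fin k → ℤ[X]), IsBatemanHornSystem f → ∀ i : Fin k,
      RoughWindowTypeI f i → CoordLayerThin f i :=
  lever_of_anchors stub_rhoPrimeWindowSum stub_roughWindowRhoSum stub_coordLayer_le_sifted
    stub_densityProduct_le stub_sifted_le

end Summit.Parity.BatemanHorn.Cruxes.BalancedSemiprimeLayer.RoughRelaxedDivisorSieve
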